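import Mathlib.Data.Fintype.Basic
import Mathlib.Order.Basic
import Mathlib.Tactic.Ring
import Mathlib.Tactic.Linarith
import Literature.Computability.Complexity.Circuit
import HarnessLib

/-!
# Deterministic protocol trees for Karchmer–Wigderson games (`KWTree`)

The Karchmer–Wigderson game of a Boolean function `h : (ι → Bool) → Bool`: Alice holds
`a ∈ h⁻¹(1)`, Bob holds `b ∈ h⁻¹(0)`, and they must agree on a coordinate `i` with `a i ≠ b i`
(the general game) resp. with `a i = 1, b i = 0` (the MONOTONE game, solvable iff `h` is monotone).
Karchmer and Wigderson proved that the least depth of a De Morgan (resp. monotone) formula for `h`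
equals the deterministic communication complexity of the general (resp. monotone) game
(Karchmer–Wigderson 1990; Jukna, *Boolean Function Complexity*, §3.3, Thm. 3.13).

This file fixes the elementary combinatorial object only — a deterministic two-party PROTOCOL TREE
over the coordinates `ι` (Kushilevitz–Nisan style: every inner node is owned by one player and
branches on one bit that is an arbitrary function of the owner's input; leaves carry the output
coordinate), its depth, number of leaves and run, the two solving predicates, and the two
"send `k` bits" combinators `aliceChoose` / `bobChoose` with their run/depth laws. The two
directions of the Karchmer–Wigderson theorem over the tree's straight-line formula model
(`Literature.Computability.Complexity.Circuit`, `formulaSizeOver`) are proved elsewhere on top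
of these definitions.

Sources: M. Karchmer, A. Wigderson, *Monotone circuits for connectivity require
super-logarithmic depth*, SIAM J. Discrete Math. 3 (1990) 255–265, §1–2 (the game `R_f`, the
monotone game `R_f^m`, Thm.: `d(f) = C(R_f)`, `d_m(f) = C(R_f^m)`); S. Jukna, *Boolean Function
Complexity* (2012), §3.3 (communication protocols as binary trees; Thm. 3.13).

Design choices:
* A protocol tree is an `inductive` with the owner's message bit an arbitrary function
  `(ι → Bool) → Bool` of the owner's input (history dependence is implicit: every node has its own
  function). `depth` = number of rounds on the longest root–leaf path, `leafCount` = number of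
  leaves (`leafCount ≤ 2 ^ depth`).
* `Solves` / `SolvesMono` quantify over ALL pairs `(a, b)` with `h a = true`, `h b = false`; for a
  constant `h` every tree solves both games vacuously, for a non-monotone `h` no tree solves the
  monotone game.
* `aliceChoose k c T` lets Alice announce the number `c a < 2 ^ k` in `k` rounds (least significant
  bit first) and continue with the tree `T (c a)`; `bobChoose` symmetrically. Values `c a ≥ 2 ^ k`
  are not excluded by the type; the run law `run_aliceChoose` carries the hypothesis `c a < 2 ^ k`.
* Deliberately NOT here: communication complexity of general relations, randomized/DAG-like
  protocols, and the minimum protocol depth of `h` as an `sInf` (users quantify over trees).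
-/

namespace Literature.Computability.Complexity

universe u

/-- A deterministic two-party **protocol tree** for a Karchmer–Wigderson game over the
coordinates `ι`: a `leaf i` outputs the coordinate `i`; at an `alice s P Q` node the holder of `a`
announces the bit `s a` and the play continues in `P` (bit `false`) or `Q` (bit `true`); at a
`bob s P Q` node the holder of `b` announces `s b` likewise.
[cite: KarchmerWigderson1990, §2 (protocols for the relation R_f)] -/
inductive KWTree (ι : Type u) : Type u
  /-- Output the coordinate `i`. -/
  | leaf : ι → KWTree ι
  /-- Alice announces the bit `s a`; continue in the first subtree on `false`, the second on `true`. -/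
  | alice : ((ι → Bool) → Bool) → KWTree ι → KWTree ι → KWTree ι
  /-- Bob announces the bit `s b`; continue in the first subtree on `false`, the second on `true`. -/
  | bob : ((ι → Bool) → Bool) → KWTree ι → KWTree ι → KWTree ι

namespace KWTree

variable {ι : Type u}

/-- The **depth** of a protocol tree: the number of rounds (bits exchanged) on a longest
root–leaf path. [cite: JuknaBFC2012, §3.3 (depth of a protocol tree = communication complexity)] -/
def depth : KWTree ι → ℕ
  | leaf _ => 0
  | alice _ P Q => max P.depth Q.depth + 1
  | bob _ P Q => max P.depth Q.depth + 1

/-- The **number of leaves** of a protocol tree. [cite: JuknaBFC2012, §3.3] -/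
def leafCount : KWTree ι → ℕ
  | leaf _ => 1
  | alice _ P Q => P.leafCount + Q.leafCount
  | bob _ P Q => P.leafCount + Q.leafCount

/-- The coordinate output by the protocol on the input pair `(a, b)` (Alice holds `a`, Bob `b`).
[cite: JuknaBFC2012, §3.3] -/
def run : KWTree ι → (ι → Bool) → (ι → Bool) → ι
  | leaf i, _, _ => i
  | alice s P Q, a, b => if s a then Q.run a b else P.run a b
  | bob s P Q, a, b => if s b then Q.run a b else P.run a b

/-- `P.Solves h`: the tree solves the (general) **Karchmer–Wigderson game** of `h` — on every
`a ∈ h⁻¹(1)`, `b ∈ h⁻¹(0)` it outputs a coordinate where `a` and `b` differ.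
[cite: KarchmerWigderson1990, §2 (the relation R_f)] -/
def Solves (P : KWTree ι) (h : (ι → Bool) → Bool) : Prop :=
  ∀ a b : ι → Bool, h a = true → h b = false → a (P.run a b) ≠ b (P.run a b)

/-- `P.SolvesMono h`: the tree solves the **monotone Karchmer–Wigderson game** of `h` — on every
`a ∈ h⁻¹(1)`, `b ∈ h⁻¹(0)` it outputs a coordinate `i` with `a i = 1` and `b i = 0`.
[cite: KarchmerWigderson1990, §2 (the monotone relation R_f^m)] -/
def SolvesMono (P : KWTree ι) (h : (ι → Bool) → Bool) : Prop :=
  ∀ a b : ι → Bool, h a = true → h b = false → a (P.run a b) = true ∧ b (P.run a b) = false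

/-- A leaf has depth `0`. [folklore] -/
@[simp] theorem depth_leaf (i : ι) : (leaf i).depth = 0 := rfl
/-- Depth of an Alice node. [folklore] -/
@[simp] theorem depth_alice (s : (ι → Bool) → Bool) (P Q : KWTree ι) :
    (alice s P Q).depth = max P.depth Q.depth + 1 := rfl
/-- Depth of a Bob node. [folklore] -/
@[simp] theorem depth_bob (s : (ι → Bool) → Bool) (P Q : KWTree ι) :
    (bob s P Q).depth = max P.depth Q.depth + 1 := rfl
/-- A leaf is one leaf. [folklore] -/
@[simp] theorem leafCount_leaf (i : ι) : (leaf i).leafCount = 1 := rfl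
/-- Leaves of an Alice node. [folklore] -/
@[simp] theorem leafCount_alice (s : (ι → Bool) → Bool) (P Q : KWTree ι) :
    (alice s P Q).leafCount = P.leafCount + Q.leafCount := rfl
/-- Leaves of a Bob node. [folklore] -/
@[simp] theorem leafCount_bob (s : (ι → Bool) → Bool) (P Q : KWTree ι) :
    (bob s P Q).leafCount = P.leafCount + Q.leafCount := rfl
/-- A leaf outputs its label. [folklore] -/
@[simp] theorem run_leaf (i : ι) (a b : ι → Bool) : (leaf i).run a b = i := rfl
/-- At an Alice node the play follows Alice's bit. [folklore] -/
@[simp] theorem run_alice (s : (ι → Bool) → Bool) (P Q : KWTree ι) (a b : ι → Bool) :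
    (alice s P Q).run a b = if s a then Q.run a b else P.run a b := rfl
/-- At a Bob node the play follows Bob's bit. [folklore] -/
@[simp] theorem run_bob (s : (ι → Bool) → Bool) (P Q : KWTree ι) (a b : ι → Bool) :
    (bob s P Q).run a b = if s b then Q.run a b else P.run a b := rfl

/-- A solution of the monotone game is a solution of the general game. [cite: KarchmerWigderson1990, §2] -/
theorem SolvesMono.solves {P : KWTree ι} {h : (ι → Bool) → Bool} (hP : P.SolvesMono h) :
    P.Solves h := by
  intro a b ha hb
  obtain ⟨h1, h2⟩ := hP a b ha hb
  simp [h1, h2]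

/-- Every protocol tree has at least one leaf. [folklore] -/
theorem one_le_leafCount : ∀ P : KWTree ι, 1 ≤ P.leafCount
  | leaf _ => le_rfl
  | alice _ P _ => le_add_right (one_le_leafCount P)
  | bob _ P _ => le_add_right (one_le_leafCount P)

/-- A protocol tree of depth `D` has at most `2 ^ D` leaves. [cite: JuknaBFC2012, §3.3] -/
theorem leafCount_le_two_pow_depth : ∀ P : KWTree ι, P.leafCount ≤ 2 ^ P.depth
  | leaf _ => by simp
  | alice _ P Q => by
    have hP := leafCount_le_two_pow_depth P
    have hQ := leafCount_le_two_pow_depth Q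
    have h1 : 2 ^ P.depth ≤ 2 ^ max P.depth Q.depth := Nat.pow_le_pow_right (by norm_num) (le_max_left _ _)
    have h2 : 2 ^ Q.depth ≤ 2 ^ max P.depth Q.depth := Nat.pow_le_pow_right (by norm_num) (le_max_right _ _)
    simp only [leafCount_alice, depth_alice, pow_succ]
    omega
  | bob _ P Q => by
    have hP := leafCount_le_two_pow_depth P
    have hQ := leafCount_le_two_pow_depth Q
    have h1 : 2 ^ P.depth ≤ 2 ^ max P.depth Q.depth := Nat.pow_le_pow_right (by norm_num) (le_max_left _ _)
    have h2 : 2 ^ Q.depth ≤ 2 ^ max P.depth Q.depth := Nat.pow_le_pow_right (by norm_num) (le_max_right _ _)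
    simp only [leafCount_bob, depth_bob, pow_succ]
    omega

/-! ### Sending a number: the `k`-round choice combinators -/

/-- **Alice announces a number.** `aliceChoose k c T`: Alice sends the `k` low bits of `c a`
(least significant first) and the play continues in `T j` where `j = c a` whenever `c a < 2 ^ k`.
[cite: JuknaBFC2012, §3.3 (a player may send ⌈log₂ t⌉ bits to name one of t alternatives)] -/
def aliceChoose : ℕ → ((ι → Bool) → ℕ) → (ℕ → KWTree ι) → KWTree ι
  | 0, _, T => T 0
  | k + 1, c, T =>
      alice (fun a => decide (c a % 2 = 1))
        (aliceChoose k (fun a => c a / 2) fun j => T (2 * j))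
        (aliceChoose k (fun a => c a / 2) fun j => T (2 * j + 1))

/-- **Bob announces a number.** `bobChoose k c T`: Bob sends the `k` low bits of `c b` and the
play continues in `T j` where `j = c b` whenever `c b < 2 ^ k`. [cite: JuknaBFC2012, §3.3] -/
def bobChoose : ℕ → ((ι → Bool) → ℕ) → (ℕ → KWTree ι) → KWTree ι
  | 0, _, T => T 0
  | k + 1, c, T =>
      bob (fun b => decide (c b % 2 = 1))
        (bobChoose k (fun b => c b / 2) fun j => T (2 * j))
        (bobChoose k (fun b => c b / 2) fun j => T (2 * j + 1))

/-- Run law of `aliceChoose`: if `c a < 2 ^ k` the play continues in `T (c a)`. [folklore] -/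
theorem run_aliceChoose : ∀ (k : ℕ) (c : (ι → Bool) → ℕ) (T : ℕ → KWTree ι) (a b : ι → Bool),
    c a < 2 ^ k → (aliceChoose k c T).run a b = (T (c a)).run a b
  | 0, c, T, a, b, h => by
    have h0 : c a = 0 := by simpa using h
    simp [aliceChoose, h0]
  | k + 1, c, T, a, b, h => by
    have hk : c a / 2 < 2 ^ k := by
      rw [pow_succ] at h
      omega
    simp only [aliceChoose, run_alice, decide_eq_true_eq]
    split
    · rename_i hodd
      rw [run_aliceChoose k _ _ a b hk]
      congr 2
      omega
    · rename_i heven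
      rw [run_aliceChoose k _ _ a b hk]
      congr 2
      omega

/-- Run law of `bobChoose`: if `c b < 2 ^ k` the play continues in `T (c b)`. [folklore] -/
theorem run_bobChoose : ∀ (k : ℕ) (c : (ι → Bool) → ℕ) (T : ℕ → KWTree ι) (a b : ι → Bool),
    c b < 2 ^ k → (bobChoose k c T).run a b = (T (c b)).run a b
  | 0, c, T, a, b, h => by
    have h0 : c b = 0 := by simpa using h
    simp [bobChoose, h0]
  | k + 1, c, T, a, b, h => by
    have hk : c b / 2 < 2 ^ k := by
      rw [pow_succ] at h
      omega
    simp only [bobChoose, run_bob, decide_eq_true_eq]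
    split
    · rename_i hodd
      rw [run_bobChoose k _ _ a b hk]
      congr 2
      omega
    · rename_i heven
      rw [run_bobChoose k _ _ a b hk]
      congr 2
      omega

/-- Depth law of `aliceChoose`: `k` rounds plus the deepest continuation among `T 0, …, T (2^k-1)`.
[folklore] -/
theorem depth_aliceChoose_le : ∀ (k : ℕ) (c : (ι → Bool) → ℕ) (T : ℕ → KWTree ι) (D : ℕ),
    (∀ j < 2 ^ k, (T j).depth ≤ D) → (aliceChoose k c T).depth ≤ k + D
  | 0, c, T, D, h => by simpa [aliceChoose] using h 0 (by norm_num)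
  | k + 1, c, T, D, h => by
    have h0 : ∀ j < 2 ^ k, (T (2 * j)).depth ≤ D := fun j hj => h _ (by rw [pow_succ]; omega)
    have h1 : ∀ j < 2 ^ k, (T (2 * j + 1)).depth ≤ D := fun j hj => h _ (by rw [pow_succ]; omega)
    have ih0 := depth_aliceChoose_le k (fun a => c a / 2) (fun j => T (2 * j)) D h0
    have ih1 := depth_aliceChoose_le k (fun a => c a / 2) (fun j => T (2 * j + 1)) D h1
    simp only [aliceChoose, depth_alice]
    omega

/-- Depth law of `bobChoose`: `k` rounds plus the deepest continuation among `T 0, …, T (2^k-1)`.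
[folklore] -/
theorem depth_bobChoose_le : ∀ (k : ℕ) (c : (ι → Bool) → ℕ) (T : ℕ → KWTree ι) (D : ℕ),
    (∀ j < 2 ^ k, (T j).depth ≤ D) → (bobChoose k c T).depth ≤ k + D
  | 0, c, T, D, h => by simpa [bobChoose] using h 0 (by norm_num)
  | k + 1, c, T, D, h => by
    have h0 : ∀ j < 2 ^ k, (T (2 * j)).depth ≤ D := fun j hj => h _ (by rw [pow_succ]; omega)
    have h1 : ∀ j < 2 ^ k, (T (2 * j + 1)).depth ≤ D := fun j hj => h _ (by rw [pow_succ]; omega)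
    have ih0 := depth_bobChoose_le k (fun b => c b / 2) (fun j => T (2 * j)) D h0
    have ih1 := depth_bobChoose_le k (fun b => c b / 2) (fun j => T (2 * j + 1)) D h1
    simp only [bobChoose, depth_bob]
    omega

/-! ### The one-round protocols -/

/-- The depth-`0` tree `leaf i` solves the monotone game of the projection `x ↦ x i`.
[cite: KarchmerWigderson1990, §2] -/
theorem solvesMono_leaf (i : ι) : (leaf i).SolvesMono fun x => x i := by
  intro a b ha hb
  exact ⟨ha, hb⟩

/-- If `P` solves the monotone game of `f` and `Q` that of `g`, then one Alice round on top solves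
the monotone game of `f ∨ g` (Alice, holding a true input of `f ∨ g`, says which disjunct is true).
[cite: KarchmerWigderson1990, §2 (proof of d_m(f) ≥ C(R_f^m))] -/
theorem solvesMono_alice_or {P Q : KWTree ι} {f g : (ι → Bool) → Bool}
    (hP : P.SolvesMono f) (hQ : Q.SolvesMono g) :
    (alice g P Q).SolvesMono fun x => f x || g x := by
  intro a b ha hb
  simp only [Bool.or_eq_true] at ha
  simp only [Bool.or_eq_false_iff] at hb
  simp only [run_alice]
  by_cases hga : g a = true
  · rw [if_pos hga]
    exact hQ a b hga hb.2
  · rw [if_neg hga]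
    have hfa : f a = true := by
      rcases ha with h | h
      · exact h
      · exact absurd h hga
    exact hP a b hfa hb.1

/-- If `P` solves the monotone game of `f` and `Q` that of `g`, then one Bob round on top solves
the monotone game of `f ∧ g` (Bob, holding a false input of `f ∧ g`, says which conjunct is false).
[cite: KarchmerWigderson1990, §2 (proof of d_m(f) ≥ C(R_f^m))] -/
theorem solvesMono_bob_and {P Q : KWTree ι} {f g : (ι → Bool) → Bool}
    (hP : P.SolvesMono f) (hQ : Q.SolvesMono g) :
    (bob (fun x => !g x) P Q).SolvesMono fun x => f x && g x := by
  intro a b ha hb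
  simp only [Bool.and_eq_true] at ha
  simp only [Bool.and_eq_false_iff] at hb
  simp only [run_bob]
  by_cases hgb : g b = false
  · rw [if_pos (by simp [hgb])]
    exact hQ a b ha.2 hgb
  · rw [if_neg (by simpa using hgb)]
    have hfb : f b = false := by
      rcases hb with h | h
      · exact h
      · exact absurd h hgb
    exact hP a b ha.1 hfb

end KWTree

end Literature.Computability.Complexity
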